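import Literature.Topology.FourManifolds.TrisectionsHandleBoxes
import Literature.Topology.FourManifolds.TrisectionsHeegaardGlobal
import Literature.Topology.FourManifolds.GradientLikeUnitField
import Literature.Topology.FourManifolds.MilnorBoxDynamics
import Literature.Topology.FourManifolds.MorseSublevelConnected
import HarnessLib

/-!
# Frame data of the trisection construction from a Morse function: `2`-handle boxes, a tube
# system, and a unit field proportional to a given gradient-like field

Topic `Literature/Topology/FourManifolds`; instantiation infrastructure for the fact seat
`provefact-Literature.Topology.FourManifolds.exists_isBalancedGKTrisection` (Gay–Kirby 2016,
Thm. 4 via §4, Lemma 14).  Everything in this file is **proved**; no definitions, no named facts.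

Given a Morse function `f` on a closed `4`-manifold with a smooth gradient-like field `ζ`
(Milnor 1965, Def. 3.1, Lemma 3.2), and a critical value `v` all of whose critical points have
index `2` while the other critical values keep distance `≥ 1` from `v` (a self-indexing `f`,
`v = 2`), this file produces the frame data used by `TriData.TubeFrame`
(`TrisectionsTubeFrame.lean`) and by `TubeSystem.exists_heegaardFunction`
(`TrisectionsHeegaardSplitting.lean`):

* `exists_milnorBoxes` — pairwise disjoint Milnor boxes (Milnor 1965, Def. 3.1 (2)) about the
  finitely many points of a finite set of critical points of index `2`, indexed by `Fin m`, with
  a common lower bound of their sizes;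
* `exists_handleBoxes_tubeSystem` — for every small `η > 0`, a system of `2`-handle boxes
  `HandleBoxes f ζ (v - η) η (Fin m)` (`TrisectionsHandleBoxes.lean`) and a tube system
  `TubeSystem f (v - η) η (Fin m)` (`TrisectionsHeegaardGlobal.lean`) **with the same charts and
  centres**;
* `exists_levelUnitField_smul` — a unit-speed field across a regular level which is a positive
  smooth multiple `ρ • ζ` of the given gradient-like field (Milnor's normalisation, proof of
  Thm. 3.4, on a band around the level).

## References

* J. Milnor, *Lectures on the h-cobordism theorem* (1965), Def. 3.1, Lemma 3.2, Thm. 3.4. [MilnorHCobordism1965]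
* D. Gay, R. Kirby, *Trisecting 4-manifolds*, Geom. Topol. 20 (2016), §4, Lemma 14. [GayKirby2016]
-/

open scoped Manifold ContDiff Topology
open Set Function Filter Metric

noncomputable section

universe u

namespace Literature.Topology.FourManifolds

/-! ### A unit field proportional to a given gradient-like field -/

section UnitField

variable {n : ℕ} {M : Type u} [TopologicalSpace M] [T2Space M] [CompactSpace M]
  [ChartedSpace (EuclideanSpace ℝ (Fin (n + 1))) M] [IsManifold (𝓡 (n + 1)) ∞ M]

/-- **A unit-speed field across a regular level, proportional to a given gradient-like field**:
`U.ξ = ρ • ζ` with `ρ` smooth and positive (`ρ = 1/ζ(f)` on a band around the level, `1` away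
from it), so that `U.ξ` is again gradient-like with the same trajectories.
[cite: MilnorHCobordism1965, Lemma 3.2 and proof of Thm. 3.4] -/
theorem exists_levelUnitField_smul {f : M → ℝ} (hf : IsMorse (𝓡 (n + 1)) f)
    {ζ : Π x : M, TangentSpace (𝓡 (n + 1)) x}
    (hζs : ContMDiff (𝓡 (n + 1)) (𝓡 (n + 1)).tangent ∞ fun x => (⟨x, ζ x⟩ : TangentBundle (𝓡 (n + 1)) M))
    (hζ : IsGradientLike (𝓡 (n + 1)) f ζ) {a : ℝ} (ha : IsRegularLevel (𝓡 (n + 1)) f a) :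
    ∃ (U : LevelUnitField n f a) (ρ : M → ℝ), ContMDiff (𝓡 (n + 1)) 𝓘(ℝ, ℝ) ∞ ρ ∧ (∀ x, 0 < ρ x) ∧
      (∀ x, U.ξ x = ρ x • ζ x) ∧ IsGradientLike (𝓡 (n + 1)) f U.ξ := by
  have hfs : ContMDiff (𝓡 (n + 1)) 𝓘(ℝ, ℝ) ∞ f := hf.1
  -- a band around the level without critical points
  have hreg0 : ∀ x, f x ∈ Icc a a → mfderiv (𝓡 (n + 1)) 𝓘(ℝ, ℝ) f x ≠ 0 := fun x hx =>
    ha.not_isMCriticalPt (le_antisymm hx.2 hx.1)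
  obtain ⟨δ, hδ, hreg⟩ := exists_pos_forall_mem_Icc_mfderiv_ne_zero hfs hreg0
  set Bd : Set M := f ⁻¹' Icc (a - δ) (a + δ) with hBd
  have hBdc : IsClosed Bd := isClosed_Icc.preimage hfs.continuous
  have hBdK : IsCompact Bd := hBdc.isCompact
  -- `ζ(f)` is smooth and positive on the band
  set ζf : M → ℝ := fun x => mlineDeriv (𝓡 (n + 1)) f x (ζ x) with hζf
  have hζfs : ContMDiff (𝓡 (n + 1)) 𝓘(ℝ, ℝ) ∞ ζf := contMDiff_mlineDeriv_section hfs hζs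
  have hζfc : Continuous ζf := hζfs.continuous
  have hζfpos : ∀ x ∈ Bd, 0 < ζf x := fun x hx => hζ.mlineDeriv_pos x (hreg x hx)
  obtain ⟨m₀, hm₀, hm₀le⟩ : ∃ m₀ : ℝ, 0 < m₀ ∧ ∀ x ∈ Bd, m₀ ≤ ζf x := by
    by_cases hne : Bd.Nonempty
    · obtain ⟨x₀, hx₀, hmin⟩ := hBdK.exists_isMinOn hne hζfc.continuousOn
      exact ⟨ζf x₀, hζfpos x₀ hx₀, fun x hx => hmin hx⟩
    · exact ⟨1, one_pos, fun x hx => (hne ⟨x, hx⟩).elim⟩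
  set mlo : ℝ := m₀ / 3 with hmlo
  set mhi : ℝ := 2 * m₀ / 3 with hmhi
  have hmlo0 : 0 < mlo := by rw [hmlo]; linarith
  have hlt : mlo < mhi := by rw [hmlo, hmhi]; linarith
  have hhi : mhi < m₀ := by rw [hmhi]; linarith
  have hZc : IsClosed {x : M | ζf x ≤ mhi} := isClosed_le hζfc continuous_const
  have hdisj : Disjoint {x : M | ζf x ≤ mhi} Bd := by
    rw [disjoint_left]
    intro x hx hxB
    exact absurd ((hm₀le x hxB).trans hx) (not_le.2 hhi)
  obtain ⟨φ, hφ0, hφ1, hφ01⟩ := exists_contMDiffMap_zero_one_of_isClosed (I := 𝓡 (n + 1)) (n := ⊤) hZc hBdc hdisj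
  have hφs : ContMDiff (𝓡 (n + 1)) 𝓘(ℝ, ℝ) ∞ φ := φ.contMDiff
  -- the rescaling factor `ρ = φ / ζ(f) + (1 - φ)`
  set ρ : M → ℝ := fun x => φ x / ζf x + (1 - φ x) with hρ
  have hρ_of_lt : ∀ x, ζf x < mhi → ρ x = 1 := fun x hx => by
    have : φ x = 0 := hφ0 (le_of_lt hx)
    simp only [hρ, this, zero_div, sub_zero, zero_add]
  have hρB : ∀ x ∈ Bd, ρ x = 1 / ζf x := fun x hx => by
    have : φ x = 1 := hφ1 hx
    simp only [hρ, this, sub_self, add_zero]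
  have hρpos : ∀ x, 0 < ρ x := fun x => by
    rcases lt_or_ge (ζf x) mhi with h | h
    · rw [hρ_of_lt x h]; exact one_pos
    · have hζx : 0 < ζf x := hmlo0.trans (hlt.trans_le h)
      have h01 := hφ01 x
      show 0 < φ x / ζf x + (1 - φ x)
      rcases h01.2.lt_or_eq with hφlt | hφeq
      · have : 0 ≤ φ x / ζf x := div_nonneg h01.1 hζx.le
        linarith
      · rw [hφeq, sub_self, add_zero]; exact div_pos one_pos hζx
  have hρs : ContMDiff (𝓡 (n + 1)) 𝓘(ℝ, ℝ) ∞ ρ := by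
    intro x
    rcases lt_or_ge (ζf x) mhi with h | h
    · have hopen : IsOpen {y : M | ζf y < mhi} := isOpen_lt hζfc continuous_const
      have hev : ρ =ᶠ[𝓝 x] fun _ => 1 := by
        filter_upwards [hopen.mem_nhds h] with y hy
        exact hρ_of_lt y hy
      exact contMDiffAt_const.congr_of_eventuallyEq hev
    · have hopen : IsOpen {y : M | mlo < ζf y} := isOpen_lt continuous_const hζfc
      have hx : x ∈ {y : M | mlo < ζf y} := hlt.trans_le h
      have hon : ContMDiffOn (𝓡 (n + 1)) 𝓘(ℝ, ℝ) ∞ ρ {y : M | mlo < ζf y} :=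
        ((hφs.contMDiffOn.div₀ hζfs.contMDiffOn fun y hy => (hmlo0.trans hy).ne')).add
          (contMDiffOn_const.sub hφs.contMDiffOn)
      exact hon.contMDiffAt (hopen.mem_nhds hx)
  -- the field `ξ = ρ ζ`
  set ξ : Π x : M, TangentSpace (𝓡 (n + 1)) x := fun x => ρ x • ζ x with hξ
  have hξs : ContMDiff (𝓡 (n + 1)) (𝓡 (n + 1)).tangent ∞
      fun x => (⟨x, ξ x⟩ : TangentBundle (𝓡 (n + 1)) M) :=
    ContMDiff.smul_section (I := 𝓡 (n + 1)) (F := EuclideanSpace ℝ (Fin (n + 1))) (V := TangentSpace (𝓡 (n + 1))) hρs hζs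
  have hξf : ∀ x, mlineDeriv (𝓡 (n + 1)) f x (ξ x) = ρ x * ζf x := fun x => mlineDeriv_smul f x (ρ x) (ζ x)
  refine ⟨⟨ξ, hξs, hfs, δ, hδ, fun x hx => ?_⟩, ρ, hρs, hρpos, fun x => rfl, ?_⟩
  · rw [hξf, hρB x hx, one_div, inv_mul_cancel₀ (hζfpos x hx).ne']
  · refine hζ.of_locallyEq (fun p hp => ?_) (fun p hp => ?_)
    · rw [hξf]; exact mul_pos (hρpos p) (hζ.mlineDeriv_pos p hp)
    · refine ⟨{y : M | ζf y < mhi}, isOpen_lt hζfc continuous_const, ?_, fun _ _ => rfl, fun q hq => ?_⟩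
      · show ζf p < mhi
        rw [show ζf p = 0 from mlineDeriv_eq_zero_of_isMCriticalPt hp _]
        exact hmlo0.trans hlt
      · show ρ q • ζ q = ζ q
        rw [hρ_of_lt q hq, one_smul]

end UnitField

/-! ### Milnor boxes about finitely many critical points of index `2` -/

variable {X : Type u} [TopologicalSpace X] [T2Space X] [CompactSpace X]
  [ChartedSpace (EuclideanSpace ℝ (Fin 4)) X] [IsManifold (𝓡 4) ∞ X]

omit [CompactSpace X] in
/-- **Pairwise disjoint Milnor boxes about the points of a finite set of critical points of index
`2`**, indexed by `Fin m`, with a common lower bound `ε₀` of their sizes. [cite: MilnorHCobordism1965, Def. 3.1 (2)] -/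
theorem exists_milnorBoxes {f : X → ℝ} (hf : IsMorse (𝓡 4) f) {ζ : Π x : X, TangentSpace (𝓡 4) x}
    (hgl : IsGradientLike (𝓡 4) f ζ) {S : Set X} (hS : S.Finite)
    (hScrit : ∀ q ∈ S, IsMCriticalPt (𝓡 4) f q) (hSidx : ∀ q ∈ S, morseIndex (𝓡 4) f q = 2) :
    ∃ (m : ℕ) (cpt : Fin m → X) (box : ∀ j, MilnorBox (𝓡 4) f ζ (cpt j)) (ε₀ : ℝ),
      Injective cpt ∧ range cpt = S ∧ (∀ j, (box j).k = 2) ∧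
      (Pairwise fun i j => Disjoint (box i).chart.source (box j).chart.source) ∧
      0 < ε₀ ∧ ∀ j, ε₀ ≤ (box j).ε := by
  obtain ⟨m, emb, hrange⟩ := hS.fin_embedding
  obtain ⟨U, hU, hdisj⟩ := hS.t2_separation
  have hcrit : ∀ j, IsMCriticalPt (𝓡 4) f (emb j) := fun j => hScrit _ (hrange ▸ mem_range_self j)
  have hbox : ∀ j, ∃ D : MilnorBox (𝓡 4) f ζ (emb j), D.chart.source ⊆ U (emb j) := fun j =>
    hgl.exists_milnorBox_source_subset (hcrit j) BoundarylessManifold.isInteriorPoint (hU (emb j)).2 (hU (emb j)).1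
      (fun _ _ => rfl)
  choose box hboxU using hbox
  have hk : ∀ j, (box j).k = 2 := by
    intro j
    have h := (box j).min_k_eq_morseIndex hf
    rw [hSidx _ (hrange ▸ mem_range_self j)] at h
    omega
  -- a common lower bound of the sizes
  obtain ⟨ε₀, hε₀, hε₀le⟩ : ∃ ε₀ : ℝ, 0 < ε₀ ∧ ∀ j, ε₀ ≤ (box j).ε := by
    by_cases hm : m = 0
    · subst hm; exact ⟨1, one_pos, fun j => j.elim0⟩
    · haveI : Nonempty (Fin m) := ⟨⟨0, Nat.pos_of_ne_zero hm⟩⟩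
      obtain ⟨j₀, hj₀⟩ := Finite.exists_min fun j => (box j).ε
      exact ⟨(box j₀).ε, (box j₀).eps_pos, hj₀⟩
  refine ⟨m, emb, box, ε₀, emb.injective, hrange, hk, fun i j hij => ?_, hε₀, hε₀le⟩
  have hne : emb i ≠ emb j := fun h => hij (emb.injective h)
  exact (hdisj (hrange ▸ mem_range_self i) (hrange ▸ mem_range_self j) hne).mono (hboxU i) (hboxU j)

/-- **`2`-handle boxes and a tube system with the same charts**, for a Morse function with a smooth
gradient-like field and a critical value `v` whose critical points all have index `2`, the other
critical values being at distance `≥ 1` from `v`: for every `0 < η ≤ η₀`, over the level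
`a = v - η`. [cite: MilnorHCobordism1965, Def. 3.1] [cite: GayKirby2016, §4, Lemma 14 and proof of Thm. 4] -/
theorem exists_handleBoxes_tubeSystem {f : X → ℝ} (hf : IsMorse (𝓡 4) f) {ζ : Π x : X, TangentSpace (𝓡 4) x}
    (hgl : IsGradientLike (𝓡 4) f ζ) {v : ℝ}
    (hv : ∀ q, IsMCriticalPt (𝓡 4) f q → f q = v → morseIndex (𝓡 4) f q = 2)
    (hsep : ∀ q, IsMCriticalPt (𝓡 4) f q → f q ≠ v → 1 ≤ |f q - v|) :
    ∃ (m : ℕ) (R η₀ : ℝ), 0 < R ∧ 0 < η₀ ∧ ∀ η, 0 < η → η ≤ η₀ →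
      ∃ (H : HandleBoxes f ζ (v - η) η (Fin m)) (TS : TubeSystem f (v - η) η (Fin m)),
        (∀ j, TS.chart j = (H.box j).chart) ∧ (∀ j, TS.centre j = H.cpt j) ∧ TS.R = R ∧
        (∀ j, f (H.cpt j) = v) ∧ range H.cpt = {q | IsMCriticalPt (𝓡 4) f q ∧ f q = v} := by
  set S : Set X := {q | IsMCriticalPt (𝓡 4) f q ∧ f q = v} with hSdef
  have hSfin : S.Finite := (IsMorse.finite_criticalSet_holds hf).subset fun q hq => hq.1
  obtain ⟨m, cpt, box, ε₀, hinj, hrange, hk, hdisj, hε₀, hε₀le⟩ :=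
    exists_milnorBoxes hf hgl hSfin (fun q hq => hq.1) (fun q hq => hv q hq.1 hq.2)
  have hcptS : ∀ j, cpt j ∈ S := fun j => hrange ▸ mem_range_self j
  set R : ℝ := 3 * ε₀ with hR
  set η₀ : ℝ := min (ε₀ ^ 2 / 4) (1 / 4) with hη₀
  have hη₀pos : 0 < η₀ := lt_min (by positivity) (by norm_num)
  refine ⟨m, R, η₀, by positivity, hη₀pos, fun η hη hηle => ?_⟩
  have hη1 : η ≤ ε₀ ^ 2 / 4 := hηle.trans (min_le_left _ _)
  have hη2 : η ≤ 1 / 4 := hηle.trans (min_le_right _ _)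
  -- the extended chart of a box is the chart (boundaryless model)
  have hext : ∀ j (x : X), (box j).chart.extend (𝓡 4) x = (box j).chart x := fun j x => by simp
  have hcrit_val : ∀ q, IsMCriticalPt (𝓡 4) f q → v - η - η ≤ f q → f q < v - η + 2 * η → ∃ j, q = cpt j := by
    intro q hq h1 h2
    have hqv : f q = v := by
      by_contra hne
      have := hsep q hq hne
      have habs : |f q - v| < 1 := by rw [abs_lt]; constructor <;> linarith
      linarith
    have : q ∈ range cpt := by rw [hrange]; exact ⟨hq, hqv⟩
    obtain ⟨j, hj⟩ := this
    exact ⟨j, hj.symm⟩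
  refine ⟨{ cpt := cpt, box := box, k_eq := hk, apply_cpt := fun j => by rw [(hcptS j).2]; ring,
            disjoint := hdisj, eta_pos := hη,
            eta_lt := fun j => by nlinarith [hε₀le j, hε₀],
            crit_val := hcrit_val },
          { chart := fun j => (box j).chart, centre := cpt,
            mem_maximalAtlas := fun j => (box j).mem_maximalAtlas,
            mem_source := fun j => (box j).mem_source,
            apply_centre := fun j => by rw [(hcptS j).2]; ring,
            apply_eq := fun j q hq => ?_,
            disjoint := hdisj, R := R, R_pos := by positivity,
            closedBall_subset := fun j => ?_,
            eta_pos := hη, eta_le := by rw [hR]; nlinarith },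
          fun j => rfl, fun j => rfl, rfl, fun j => (hcptS j).2, hrange⟩
  · -- Milnor's normal form of index `2`
    have h := (box j).apply_eq q hq
    rw [hk j, hext, hext] at h
    exact h
  · -- the common closed ball
    have h := (box j).closedBall_subset
    rw [hext, OpenPartialHomeomorph.extend_target, modelWithCornersSelf_coe_symm, preimage_id_eq, id,
      ModelWithCorners.range_eq_univ, inter_univ] at h
    exact (closedBall_subset_closedBall (by rw [hR]; linarith [hε₀le j])).trans h

end Literature.Topology.FourManifolds

end
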